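/-
Origin: expansion seat `prover-pub-hodgecm-mc-binder-1-g18-0`, handover #R127 2026-08-21T02:09:41Z md5 71ec221bd3fc (218 l.; NEW additive MODEL leaf, ns HodgeCM.Model.ThetaAdelicSide; imports #R126 (this kit) + carch RUN-69 rows #CA66 Model/ArchKTypeOfDist34 and #CA67 Model/ArchKTypeOfDistHol34; install AFTER #R126; drop-alone below it; 0 records, 0 `def … : Prop`, two data defs (`pinDatumTwo/Three` = sinst-1 #1258 `thetaDistDatumTwoOf/ThreeOf` at Φarch := blockFamilyOfAt … (lineVec (dW′ c.D 0/1)) … eR eS (degOnePDual Empty) (binvPi 1), harm := #CA66 `harm_lineOmega_two/threeG … (binvPi 1) hemb eR eS hχ` (no sign fact), hdef := #CA66 `harch_two/three_of_defType_tmulG … hV eR eS a hω hdefI`), nothing cited; = the SLOT-2/3 TWIN of #R125r2: `clsU_mem_iSup_block_of_mem_holSat_pinTwo/Three (h𝓕) (hι) (Γ) (hF : F ∈ (archSideOf …).holSat hV 2/3 Γ 𝓕) : ∃ hF', clsU … ⟨F, hF'⟩ ∈ ⨆_{χ, charInv χ ∈ 𝓕} ⨆ ψ : ((pinDatumTwo/Three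 …).coinvRep χ).asModule →ₗ Tower, range ψ` with hd/hCR by #CA67 `hd/hCR_lineOmega_two/threeG … (binvPi 1) eR eS hemb`, Φarch ≠ 0 by PKG `blockFamilyOfAt_degOnePDual_binvPi_one_ne_zero`, hrk by #CA68 through #R126's `_of_ne_zero` — NO archimedean hypothesis; cert lean-direct over the RUN-68 PKG oleans + STAGED #1257–#1259 ∕ #CA66–#CA68 ∕ my #R126: rc 0 ∕ 0 warn ∕ 0 proof-hole 80 s; `#print axioms` 4 ∕ 4 trio (`farm/logs/ax_multpin34.log`); FQN vs PKG + carch/sinst stage69: 0 ∕ 0; NAMES for audit: HodgeCM.Model.ThetaAdelicSide.clsU_mem_iSup_block_of_mem_holSat_pinTwo · HodgeCM.Model.ThetaAdelicSide.clsU_mem_iSup_block_of_mem_holSat_pinThree; NAME LIST: HodgeCM.Model.ThetaAdelicSide.clsU_mem_iSup_block_of_mem_holSat_pinTwo · HodgeCM.Model.ThetaAdelicSide.clsU_mem_iSup_block_of_mem_holSat_pinThree; all decls: HodgeCM.Model.ThetaAdelicSide.pinDatumTwo (def) · HodgeCM.Model.ThetaAdelicSide.clsU_mem_iSup_block_of_mem_holSat_pinTwo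 · HodgeCM.Model.ThetaAdelicSide.pinDatumThree (def) · HodgeCM.Model.ThetaAdelicSide.clsU_mem_iSup_block_of_mem_holSat_pinThree) (`HOME/mc/pub-hodgecm-mc-binder-1-g18/stage70/HodgeCM/Model/AdelicThetaDistributionMultPin34.lean`, md5 71ec221bd3fc, 218 lines);
landed by the second packager p2 gen 17 (p2-g17) in gate run 70 as `HodgeCM/Model/AdelicThetaDistributionMultPin34.lean` (verbatim).
-/
/-
Copyright (c) 2026 the pub-hodgecm formalisation cell (harness21).  New file, not vendored.
Origin: session prover-pub-hodgecm-mc-binder-1-g18-0 (unit pub-hodgecm-mc-binder-1-g18, BINDER PROVER gen 18; `hfam` clause 2 for EVERY theta form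
of slots 2/3 of the honest adelic side (the slot-2/3 twin of #R125r2) with the pin's archimedean inputs PLUGGED: carch #CA66 `harm_lineOmega_kG`/`harch_k_of_defType_tmulG`,
#CA67 `hd_lineOmega_kG`/`hCR_lineOmega_kG` (k = 2, 3), PKG `blockFamilyOfAt_degOnePDual_binvPi_one_ne_zero`, and — r2 — the (J4-mult1) RANK statement itself,
KERNEL-PROVED by carch #CA64/#CA68 (`rank_admFamilies_thetaDistDatumTwoOf/ThreeOf_le_one`): NO archimedean hypothesis is left), 2026-08-21.
Intended final place: `HodgeCM/Model/AdelicThetaDistributionMultPin34.lean` (NEW additive model-layer leaf; imports binder-1's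
`HodgeCM.Model.AdelicThetaDistributionMultEnd34` (#R126) and carch's `HodgeCM.Model.ArchKTypeOfDist34` (#CA66) / `HodgeCM.Model.ArchKTypeOfDistHol34`
(#CA67) (the slot-2/3 rank input #CA68 comes through #R126); nothing imports it; drop alone).
-/
import Summits.HodgeConjecture.HodgeCM.Model.AdelicThetaDistributionMultEnd34
import Summits.HodgeConjecture.HodgeCM.Model.ArchKTypeOfDist34
import Summits.HodgeConjecture.HodgeCM.Model.ArchKTypeOfDistHol34

set_option autoImplicit false

/-!
# `hfam` clause 2 at the pin: the honest side, SLOTS 2 AND 3, standard family `blockFamilyOfAt … (degOnePDual Empty) (binvPi 1)` on the conjugated lines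

For `S := archSideOf V c hGR hGR₀ hGR₁ hGR₂ hGR₃ η hη hηc h₁W A` and the slot-`k` product Weil datum of #1250 at the STANDARD harmonic family
`Φarch := blockFamilyOfAt … eR eS (degOnePDual Empty) (binvPi 1)` (carch's (C-Kf∞) currency):
* `pinDatumTwo/Three …` — `thetaDistDatumTwoOf/ThreeOf …` (#1258) with `harm := harm_lineOmega_two/threeG …` (#CA66, inputs `hemb`,
  the slot equivalences `eR eS`, the character identity `hχ` — no sign fact on the conjugated lines) and `hdef := harch_two/three_of_defType_tmulG …` (#CA66, inputs the definite exponent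
  table `a`/`hω` and the definite-type identity `hdefI`);
* **`clsU_mem_iSup_block_of_mem_holSat_pinTwo/Three`**: for weight functions `𝓕 ⊆ {charInv χ}`, EVERY `F ∈ S.holSat hV k Γ 𝓕` lies in `holSatU`
  and its tower class lies in `⨆_{χ, charInv χ ∈ 𝓕} block(Ω_k(χ))`, `k = 2, 3` — #R126 `clsU_mem_iSup_block_of_mem_holSat_archSideOf_two/three_of_ne_zero`
  with (AN)/(REP′) `hd`/`hCR` DISCHARGED by #CA67 `hd_lineOmega_kG`/`hCR_lineOmega_kG`, `Φarch ≠ 0` by PKG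
  `ArchSideTerm.blockFamilyOfAt_degOnePDual_binvPi_one_ne_zero`, `har` by #CA44 (inside #R126), `hGfin`/`hLF` as in #1259, and the (J4-mult1)
  RANK input by carch #CA68 `rank_admFamilies_thetaDistDatumTwoOf/ThreeOf_le_one` (inside #R126's `_of_ne_zero`) (KERNEL: the 9-torus / Hermite-line argument of #CA63–#CA64); hypotheses LEFT: the pin
  data above, `hι`, `h𝓕` — nothing archimedean, nothing cited.
KERNEL only: two data `def`s (terms of the #1246 structure), 0 records, 0 `def … : Prop`, nothing cited; `#print axioms` ⊆ {propext, Classical.choice,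
Quot.sound}.
-/

noncomputable section

open NumberField hiding relNormOneIdeles relNormOneRat probHaarRelNormOneQuot
open _root_.NumberField.InfinitePlace _root_.NumberField.mixedEmbedding MeasureTheory MulAction IsDedekindDomain
open scoped Matrix TensorProduct Classical SchwartzMap
open Literature.Geometry.ComplexHyperbolic.BallModel (U21 x₀ stabilizerEquivK21)
open Literature.NumberTheory.Automorphic.U21 (K21 matA sclD)
open Literature.NumberTheory.Automorphic Literature.NumberTheory.Automorphic.UnitaryGroup Literature.NumberTheory.Weil1964
open Literature.NumberTheory.GelbartRogawski1991 Literature.NumberTheory.GelbartRogawski1991.UnitaryDualPair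
open Literature.AlgebraicGeometry.HodgeTheory Literature.AlgebraicGeometry.ShimuraVarieties Literature.AlgebraicGeometry.ShimuraVarieties.BallForms
open Literature.NumberTheory.Automorphic.PicardCM
open Literature.NumberTheory.Transcendental (Arapura2012_Cor_15_4_6)
open Literature.Analysis.SegalBargmann
open HodgeCM.Adelic HodgeCM.PerL34 HodgeCM.Model.HypCensus HodgeCM.Model.ArchSideTerm HodgeCM.Model.ThetaDistFin HodgeCM.Model.TowerCarrier
open HodgeCM.Model.SupplyInstance HodgeCM.Model.SupplyResidual HodgeCM.Model.ThetaSpace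
open HodgeCM.Model.SupplyResidual.WeilPairData (charInv)

namespace HodgeCM.Model
namespace ThetaAdelicSide

variable (hHD : exists_isReal_hodgeModel) (hI : hodgePQ_independent_of_hodgeModel)
  (h₁ : BallQuotientUniformised) (h₃ : CMAbelianVarietyRealised) (hA : Arapura2012_Cor_15_4_6)
variable {L : CMField} {ι₁ : L →+* ℂ} (V : HermSpace3 L ι₁) (c : SeesawCtx L)
  (hGR : (cmSplittingDatum (L : Type) finProdFinEquiv (frameD V) (frameD_real V) (frameD_ne V) (dW c.D) (dW_real c.D)
    (dW_ne c.D)).CompatibleSplitting)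
  (hGR₀ : (cmSplittingDatum (L : Type) (e₁) (frameD V) (frameD_real V) (frameD_ne V) (lineVec (L : Type) (dW c.D 0))
    (fun _ => dW_real c.D 0) (fun _ => dW_ne c.D 0)).CompatibleSplitting)
  (hGR₁ : (cmSplittingDatum (L : Type) (e₁) (frameD V) (frameD_real V) (frameD_ne V) (lineVec (L : Type) (dW c.D 1))
    (fun _ => dW_real c.D 1) (fun _ => dW_ne c.D 1)).CompatibleSplitting)
  (hGR₂ : (cmSplittingDatum (L : Type) (e₁) (frameD V) (frameD_real V) (frameD_ne V) (lineVec (L : Type) (dW' c.D 0))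
    (fun _ => dW'_real c.D 0) (fun _ => dW'_ne c.D 0)).CompatibleSplitting)
  (hGR₃ : (cmSplittingDatum (L : Type) (e₁) (frameD V) (frameD_real V) (frameD_ne V) (lineVec (L : Type) (dW' c.D 1))
    (fun _ => dW'_real c.D 1) (fun _ => dW'_ne c.D 1)).CompatibleSplitting)
  (η : CMAdelic (L : Type) (frameD V) × CMAdelic (L : Type) (dW c.D) →* ℂˣ)
  (hη : ∀ γU ∈ CMRat (L : Type) (frameD V), ∀ γ ∈ CMRat (L : Type) (dW c.D), η (γU, γ) = 1)
  (hηc : Continuous fun p => ((η p : ℂˣ) : ℂ))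
  (h₁W : (∀ j, 0 < (ι₁ (dW c.D j)).re) ∨ ∀ j, (ι₁ (dW c.D j)).re < 0)
  (A : ∀ k : Fin 4, ArchLineInput V (lineRepD V c.D hGR hGR₀ hGR₁ hGR₂ hGR₃ η k))
  (hV : IsAnisotropic L V.Hm)
  (hemb : (InfinitePlace.mk ι₁).embedding = ι₁)

/-! ### § 1. Slot 2 -/

section Two

variable
  (eR : PosIdx (cmXW (L : Type) (frameD V) (lineVec (L : Type) (dW' c.D 0)) (fun _ => dW'_real c.D 0) ι₁ (HypCensus.cmPlace (L : Type) ι₁)) ≃ Unit)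
  (eS : NegIdx (cmXW (L : Type) (frameD V) (lineVec (L : Type) (dW' c.D 0)) (fun _ => dW'_real c.D 0) ι₁ (HypCensus.cmPlace (L : Type) ι₁)) ≃ Empty)
  (hχ : ∀ u : stabilizer U21 x₀,
    ((lineScalar_two V c.D hGR hGR₂ hGR₃ (eta₂ V c.D η) (u : U21) : ℂˣ) : ℂ) *
        ((matA (stabilizerEquivK21.symm u)).det ^ (lineVacExponentsTwo V c hGR₂ eR eS).eP *
          sclD (stabilizerEquivK21.symm u) ^ (lineVacExponentsTwo V c hGR₂ eR eS).eQ) =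
      star (sclD (stabilizerEquivK21.symm u)))
  (a : {v : InfinitePlace ↥(maximalRealSubfield L) // v.IsReal} → ℤ)
  (hω : ∀ b : {v : InfinitePlace ↥(maximalRealSubfield L) // v.IsReal}, b ≠ HypCensus.cmPlace (L : Type) ι₁ →
    ∀ (u : UnitaryGroup.archLocal (L : Type) 3 (Matrix.diagonal (frameD V)) (cmPlaceOver (L : Type) b)) (ℓ : Module.Dual ℂ (Fin 2 → ℂ)),
      cmArchWeilRep (L : Type) e₁ (frameD V) (frameD_real V) (frameD_ne V) (lineVec (L : Type) (dW' c.D 0)) (fun _ => dW'_real c.D 0)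
          (fun _ => dW'_ne c.D 0) hGR₂
          (UnitaryGroup.archSingle (↥(maximalRealSubfield L)) L (IsCMField.complexConj L) 3 (Matrix.diagonal (frameD V))
            (IsCMField.complexConj_ne_one L) (NumberField.complexConj_smul_infinitePlace (L : Type)) (cmPlaceOver (L : Type) b) u, 1)
          (blockFamilyOfAt (L : Type) e₁ (frameD V) (frameD_real V) (frameD_ne V) (lineVec (L : Type) (dW' c.D 0)) (fun _ => dW'_real c.D 0)
            (fun _ => dW'_ne c.D 0) ι₁ (blockPosEquiv V) (blockNegEquiv V) eR eS (degOnePDual Empty) (binvPi 1) ℓ) =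
        (((u : UnitaryGroup.archLocal (L : Type) 3 (Matrix.diagonal (frameD V)) (cmPlaceOver (L : Type) b)) : GL (Fin 3) ℂ) :
            Matrix (Fin 3) (Fin 3) ℂ).det ^ a b •
          blockFamilyOfAt (L : Type) e₁ (frameD V) (frameD_real V) (frameD_ne V) (lineVec (L : Type) (dW' c.D 0)) (fun _ => dW'_real c.D 0)
            (fun _ => dW'_ne c.D 0) ι₁ (blockPosEquiv V) (blockNegEquiv V) eR eS (degOnePDual Empty) (binvPi 1) ℓ)
  (hdefI : ∀ b : {v : InfinitePlace ↥(maximalRealSubfield L) // v.IsReal}, b ≠ HypCensus.cmPlace (L : Type) ι₁ →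
    ∀ u : UnitaryGroup.archLocal (L : Type) 3 (Matrix.diagonal (frameD V)) (cmPlaceOver (L : Type) b),
      ((archScalar_twoG V c.D hGR hGR₂ hGR₃ (eta₂ V c.D η)
          (UnitaryGroup.archSingle (↥(maximalRealSubfield L)) L (IsCMField.complexConj L) 3 (Matrix.diagonal (frameD V))
            (IsCMField.complexConj_ne_one L) (NumberField.complexConj_smul_infinitePlace (L : Type)) (cmPlaceOver (L : Type) b) u) : ℂˣ) : ℂ) *
        (((u : UnitaryGroup.archLocal (L : Type) 3 (Matrix.diagonal (frameD V)) (cmPlaceOver (L : Type) b)) : GL (Fin 3) ℂ) :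
            Matrix (Fin 3) (Fin 3) ℂ).det ^ a b = 1)

/-- **The slot-2 product Weil datum AT THE PIN**: #1250 `thetaDistDatumTwoOf …` at the standard harmonic family
`blockFamilyOfAt … eR eS (degOnePDual Empty) (binvPi 1)`, with `harm`/`hdef` supplied by carch #CA61. -/
def pinDatumTwo : ThetaDistDatum (archSideOf V c hGR hGR₀ hGR₁ hGR₂ hGR₃ η hη hηc h₁W A) hV 2 :=
  thetaDistDatumTwoOf V c hGR hGR₀ hGR₁ hGR₂ hGR₃ η hη hηc h₁W A hV
    (blockFamilyOfAt (L : Type) e₁ (frameD V) (frameD_real V) (frameD_ne V) (lineVec (L : Type) (dW' c.D 0)) (fun _ => dW'_real c.D 0)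
      (fun _ => dW'_ne c.D 0) ι₁ (blockPosEquiv V) (blockNegEquiv V) eR eS (degOnePDual Empty) (binvPi 1))
    (harm_lineOmega_twoG V c hGR hGR₂ hGR₃ (eta₂ V c.D η) (binvPi 1) hemb eR eS hχ)
    (harch_two_of_defType_tmulG V c.D hGR hGR₀ hGR₁ hGR₂ hGR₃ (eta₀ V c.D η) (eta₁ V c.D η) (eta₂ V c.D η) (eta₃ V c.D η) hV eR eS a hω hdefI)

/-- **`hfam` clause 2 at the pin, slot 2 — NO archimedean hypothesis**: EVERY saturated hol-germ theta form `F ∈ holSat Γ 𝓕` of slot 2 of the honest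
side (`𝓕 ⊆ {charInv χ}`) lies in `holSatU` and has its tower class in `⨆_{χ, charInv χ ∈ 𝓕} block(Ω₂(χ))` ((J4-mult1) supplied by carch #CA65). -/
theorem clsU_mem_iSup_block_of_mem_holSat_pinTwo
    {𝓕 : Set C(↥(relNormOneIdeles (↥(maximalRealSubfield L)) L) ⧸ relNormOneRat (↥(maximalRealSubfield L)) L, ℂ)}
    (h𝓕 : ∀ f ∈ 𝓕, ∃ χ : PontryaginDual (↥(relNormOneIdeles (↥(maximalRealSubfield L)) L) ⧸ relNormOneRat (↥(maximalRealSubfield L)) L),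
      f = charInv χ)
    (hι : (archSideOf V c hGR hGR₀ hGR₁ hGR₂ hGR₃ η hη hηc h₁W A).ιinf = archInfOf V) (Γ : Level V)
    {F : (V.latticeModel printFact_unitaryCompact_holds).G → (Fin 2 → ℂ)}
    (hF : F ∈ (archSideOf V c hGR hGR₀ hGR₁ hGR₂ hGR₃ η hη hηc h₁W A).holSat hV 2 Γ 𝓕) :
    ∃ hF' : F ∈ (archSideOf V c hGR hGR₀ hGR₁ hGR₂ hGR₃ η hη hηc h₁W A).holSatU hV 2 𝓕,
      (archSideOf V c hGR hGR₀ hGR₁ hGR₂ hGR₃ η hη hηc h₁W A).clsU hHD hI h₁ h₃ hA 𝓕 hι hV 2 ⟨F, hF'⟩ ∈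
        ⨆ (χ : PontryaginDual (↥(relNormOneIdeles (↥(maximalRealSubfield L)) L) ⧸ relNormOneRat (↥(maximalRealSubfield L)) L))
          (_ : charInv χ ∈ 𝓕),
          ⨆ ψ : ((pinDatumTwo V c hGR hGR₀ hGR₁ hGR₂ hGR₃ η hη hηc h₁W A hV hemb eR eS hχ a hω hdefI).coinvRep χ).asModule
              →ₗ[MonoidAlgebra ℂ ↥V.adelicFin] Tower hHD hI (ballQuotientUniformisedDatum_of h₁) h₃ hA V,
            (LinearMap.range ψ).restrictScalars ℂ :=
  clsU_mem_iSup_block_of_mem_holSat_archSideOf_two_of_ne_zero hHD hI h₁ h₃ hA V c hGR hGR₀ hGR₁ hGR₂ hGR₃ η hη hηc h₁W A hV _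
    (harm_lineOmega_twoG V c hGR hGR₂ hGR₃ (eta₂ V c.D η) (binvPi 1) hemb eR eS hχ)
    (harch_two_of_defType_tmulG V c.D hGR hGR₀ hGR₁ hGR₂ hGR₃ (eta₀ V c.D η) (eta₁ V c.D η) (eta₂ V c.D η) (eta₃ V c.D η) hV eR eS a hω hdefI)
    (hd_lineOmega_twoG V c hGR hGR₂ hGR₃ (eta₂ V c.D η) (binvPi 1) eR eS hemb)
    (hCR_lineOmega_twoG V c hGR hGR₂ hGR₃ (eta₂ V c.D η) (binvPi 1) eR eS hemb) h𝓕
    (fun h => ArchSideTerm.blockFamilyOfAt_degOnePDual_binvPi_one_ne_zero Empty (L : Type) e₁ (frameD V) (frameD_real V) (frameD_ne V)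
      (lineVec (L : Type) (dW' c.D 0)) (fun _ => dW'_real c.D 0) (fun _ => dW'_ne c.D 0) ι₁ (blockPosEquiv V) (blockNegEquiv V) eR eS
      (by rw [h]; rfl))
    hι Γ hF

end Two

/-! ### § 2. Slot 3 -/

section Three

variable
  (eR : PosIdx (cmXW (L : Type) (frameD V) (lineVec (L : Type) (dW' c.D 1)) (fun _ => dW'_real c.D 1) ι₁ (HypCensus.cmPlace (L : Type) ι₁)) ≃ Unit)
  (eS : NegIdx (cmXW (L : Type) (frameD V) (lineVec (L : Type) (dW' c.D 1)) (fun _ => dW'_real c.D 1) ι₁ (HypCensus.cmPlace (L : Type) ι₁)) ≃ Empty)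
  (hχ : ∀ u : stabilizer U21 x₀,
    ((lineScalar_three V c.D hGR hGR₂ hGR₃ (eta₃ V c.D η) (u : U21) : ℂˣ) : ℂ) *
        ((matA (stabilizerEquivK21.symm u)).det ^ (lineVacExponentsThree V c hGR₃ eR eS).eP *
          sclD (stabilizerEquivK21.symm u) ^ (lineVacExponentsThree V c hGR₃ eR eS).eQ) =
      star (sclD (stabilizerEquivK21.symm u)))
  (a : {v : InfinitePlace ↥(maximalRealSubfield L) // v.IsReal} → ℤ)
  (hω : ∀ b : {v : InfinitePlace ↥(maximalRealSubfield L) // v.IsReal}, b ≠ HypCensus.cmPlace (L : Type) ι₁ →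
    ∀ (u : UnitaryGroup.archLocal (L : Type) 3 (Matrix.diagonal (frameD V)) (cmPlaceOver (L : Type) b)) (ℓ : Module.Dual ℂ (Fin 2 → ℂ)),
      cmArchWeilRep (L : Type) e₁ (frameD V) (frameD_real V) (frameD_ne V) (lineVec (L : Type) (dW' c.D 1)) (fun _ => dW'_real c.D 1)
          (fun _ => dW'_ne c.D 1) hGR₃
          (UnitaryGroup.archSingle (↥(maximalRealSubfield L)) L (IsCMField.complexConj L) 3 (Matrix.diagonal (frameD V))
            (IsCMField.complexConj_ne_one L) (NumberField.complexConj_smul_infinitePlace (L : Type)) (cmPlaceOver (L : Type) b) u, 1)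
          (blockFamilyOfAt (L : Type) e₁ (frameD V) (frameD_real V) (frameD_ne V) (lineVec (L : Type) (dW' c.D 1)) (fun _ => dW'_real c.D 1)
            (fun _ => dW'_ne c.D 1) ι₁ (blockPosEquiv V) (blockNegEquiv V) eR eS (degOnePDual Empty) (binvPi 1) ℓ) =
        (((u : UnitaryGroup.archLocal (L : Type) 3 (Matrix.diagonal (frameD V)) (cmPlaceOver (L : Type) b)) : GL (Fin 3) ℂ) :
            Matrix (Fin 3) (Fin 3) ℂ).det ^ a b •
          blockFamilyOfAt (L : Type) e₁ (frameD V) (frameD_real V) (frameD_ne V) (lineVec (L : Type) (dW' c.D 1)) (fun _ => dW'_real c.D 1)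
            (fun _ => dW'_ne c.D 1) ι₁ (blockPosEquiv V) (blockNegEquiv V) eR eS (degOnePDual Empty) (binvPi 1) ℓ)
  (hdefI : ∀ b : {v : InfinitePlace ↥(maximalRealSubfield L) // v.IsReal}, b ≠ HypCensus.cmPlace (L : Type) ι₁ →
    ∀ u : UnitaryGroup.archLocal (L : Type) 3 (Matrix.diagonal (frameD V)) (cmPlaceOver (L : Type) b),
      ((archScalar_threeG V c.D hGR hGR₂ hGR₃ (eta₃ V c.D η)
          (UnitaryGroup.archSingle (↥(maximalRealSubfield L)) L (IsCMField.complexConj L) 3 (Matrix.diagonal (frameD V))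
            (IsCMField.complexConj_ne_one L) (NumberField.complexConj_smul_infinitePlace (L : Type)) (cmPlaceOver (L : Type) b) u) : ℂˣ) : ℂ) *
        (((u : UnitaryGroup.archLocal (L : Type) 3 (Matrix.diagonal (frameD V)) (cmPlaceOver (L : Type) b)) : GL (Fin 3) ℂ) :
            Matrix (Fin 3) (Fin 3) ℂ).det ^ a b = 1)

/-- **The slot-3 product Weil datum AT THE PIN**: #1250 `thetaDistDatumThreeOf …` at the standard harmonic family
`blockFamilyOfAt … eR eS (degOnePDual Empty) (binvPi 1)`, with `harm`/`hdef` supplied by carch #CA61. -/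
def pinDatumThree : ThetaDistDatum (archSideOf V c hGR hGR₀ hGR₁ hGR₂ hGR₃ η hη hηc h₁W A) hV 3 :=
  thetaDistDatumThreeOf V c hGR hGR₀ hGR₁ hGR₂ hGR₃ η hη hηc h₁W A hV
    (blockFamilyOfAt (L : Type) e₁ (frameD V) (frameD_real V) (frameD_ne V) (lineVec (L : Type) (dW' c.D 1)) (fun _ => dW'_real c.D 1)
      (fun _ => dW'_ne c.D 1) ι₁ (blockPosEquiv V) (blockNegEquiv V) eR eS (degOnePDual Empty) (binvPi 1))
    (harm_lineOmega_threeG V c hGR hGR₂ hGR₃ (eta₃ V c.D η) (binvPi 1) hemb eR eS hχ)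
    (harch_three_of_defType_tmulG V c.D hGR hGR₀ hGR₁ hGR₂ hGR₃ (eta₀ V c.D η) (eta₁ V c.D η) (eta₂ V c.D η) (eta₃ V c.D η) hV eR eS a hω hdefI)

/-- **`hfam` clause 2 at the pin, slot 3 — NO archimedean hypothesis** ((J4-mult1) supplied by carch #CA65). -/
theorem clsU_mem_iSup_block_of_mem_holSat_pinThree
    {𝓕 : Set C(↥(relNormOneIdeles (↥(maximalRealSubfield L)) L) ⧸ relNormOneRat (↥(maximalRealSubfield L)) L, ℂ)}
    (h𝓕 : ∀ f ∈ 𝓕, ∃ χ : PontryaginDual (↥(relNormOneIdeles (↥(maximalRealSubfield L)) L) ⧸ relNormOneRat (↥(maximalRealSubfield L)) L),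
      f = charInv χ)
    (hι : (archSideOf V c hGR hGR₀ hGR₁ hGR₂ hGR₃ η hη hηc h₁W A).ιinf = archInfOf V) (Γ : Level V)
    {F : (V.latticeModel printFact_unitaryCompact_holds).G → (Fin 2 → ℂ)}
    (hF : F ∈ (archSideOf V c hGR hGR₀ hGR₁ hGR₂ hGR₃ η hη hηc h₁W A).holSat hV 3 Γ 𝓕) :
    ∃ hF' : F ∈ (archSideOf V c hGR hGR₀ hGR₁ hGR₂ hGR₃ η hη hηc h₁W A).holSatU hV 3 𝓕,
      (archSideOf V c hGR hGR₀ hGR₁ hGR₂ hGR₃ η hη hηc h₁W A).clsU hHD hI h₁ h₃ hA 𝓕 hι hV 3 ⟨F, hF'⟩ ∈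
        ⨆ (χ : PontryaginDual (↥(relNormOneIdeles (↥(maximalRealSubfield L)) L) ⧸ relNormOneRat (↥(maximalRealSubfield L)) L))
          (_ : charInv χ ∈ 𝓕),
          ⨆ ψ : ((pinDatumThree V c hGR hGR₀ hGR₁ hGR₂ hGR₃ η hη hηc h₁W A hV hemb eR eS hχ a hω hdefI).coinvRep χ).asModule
              →ₗ[MonoidAlgebra ℂ ↥V.adelicFin] Tower hHD hI (ballQuotientUniformisedDatum_of h₁) h₃ hA V,
            (LinearMap.range ψ).restrictScalars ℂ :=
  clsU_mem_iSup_block_of_mem_holSat_archSideOf_three_of_ne_zero hHD hI h₁ h₃ hA V c hGR hGR₀ hGR₁ hGR₂ hGR₃ η hη hηc h₁W A hV _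
    (harm_lineOmega_threeG V c hGR hGR₂ hGR₃ (eta₃ V c.D η) (binvPi 1) hemb eR eS hχ)
    (harch_three_of_defType_tmulG V c.D hGR hGR₀ hGR₁ hGR₂ hGR₃ (eta₀ V c.D η) (eta₁ V c.D η) (eta₂ V c.D η) (eta₃ V c.D η) hV eR eS a hω hdefI)
    (hd_lineOmega_threeG V c hGR hGR₂ hGR₃ (eta₃ V c.D η) (binvPi 1) eR eS hemb)
    (hCR_lineOmega_threeG V c hGR hGR₂ hGR₃ (eta₃ V c.D η) (binvPi 1) eR eS hemb) h𝓕
    (fun h => ArchSideTerm.blockFamilyOfAt_degOnePDual_binvPi_one_ne_zero Empty (L : Type) e₁ (frameD V) (frameD_real V) (frameD_ne V)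
      (lineVec (L : Type) (dW' c.D 1)) (fun _ => dW'_real c.D 1) (fun _ => dW'_ne c.D 1) ι₁ (blockPosEquiv V) (blockNegEquiv V) eR eS
      (by rw [h]; rfl))
    hι Γ hF

end Three

end ThetaAdelicSide
end HodgeCM.Model

end
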